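import Literature.NumberTheory.GaloisRepresentations.ContinuousShapiroLiftFunctor
import Literature.NumberTheory.GaloisRepresentations.ContinuousCupProductCompatMixed
import HarnessLib

/-!
# Mixed-variance («projection formula») naturality of the Shapiro cup classes in the coefficients

Generic continuous group cohomology; namespace `Literature.NumberTheory.GaloisRepresentations`. Theorems only
(no definition, no named fact, no instance). Sequel of `ContinuousShapiroLiftFunctor.lean` (covariant
naturality `cupProduct_coindFin_map`) in MIXED variance, the shape needed to TRANSPORT CUP CLASSES ALONG A
CHANGE OF LEVEL `μ_d ⊆ μ_n`, `E[d] ⊆ E[n]`, `[n/d] : E[n] → E[d]`: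

for pairings `⟨ , ⟩₁ : X₁ × Y₁ → Z₁`, `⟨ , ⟩₂ : X₂ × Y₂ → Z₂` and morphisms `α : X₂ → X₁`, `β : Y₁ → Y₂`,
`γ : Z₁ → Z₂` with `γ⟨α x, y⟩₁ = ⟨x, β y⟩₂`,

* `ContPairing.coindFin_toLin_map_adjoint` — the module identity for the SUMMED pairings on `Maps(G ⧸ N, ·)`:
  `γ(Σ_y ⟨α φ(y), ψ(y)⟩₁) = Σ_y ⟨φ(y), β ψ(y)⟩₂`;
* `ContPairing.cupProduct_coindFin_map_adjoint` — `H²(γ)(H¹(Maps(α)) a ∪_{Σ₁} b) = a ∪_{Σ₂} H¹(Maps(β)) b`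
  (the tree's `cupProduct_map_adjoint` for the summed pairings);
* **`shapiroLift_cupProduct_coindFin_map_adjoint`** — on Shapiro lifts of layer classes
  `a ∈ H¹(N, X₂)`, `b ∈ H¹(N, Y₁)`:
  `H²(γ)( Sh(H¹(α|_N) a) ∪_{Σ₁} Sh b ) = Sh a ∪_{Σ₂} Sh(H¹(β|_N) b)`
  (with `shapiroLift_cohomologyMap`: the Shapiro lift is natural in the coefficients).

Consumer: the level transport `c_{K'} = (ι_μ)_* c_K` of the global Shapiro cup classes
`c_K = Sh(a_K) ∪_{Σ e_K} Sh(b_K) ∈ H²(Γ_ℚ, μ_{2^K})` of crux K3 (`Summits/BirchSwinnertonDyer`, (PT-orth) step [S2-B3]),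
where `a_K = [2^{K'-K}]_* a_{K'}`, `b_{K'} = ι_* b_K` and the Weil pairings are compatible
(`e_{K'}(S, ι T) = ι e_K(2^{K'-K} S, T)`, Silverman AEC III.8.1 (e) = the tree's `weilPairingFun_mul`).

## References
* J. Neukirch, A. Schmidt, K. Wingberg, *Cohomology of Number Fields* (2008), I §4 (1.4.2)–(1.4.3), I §6 (1.6.4).
  [NeukirchSchmidtWingberg2008]
-/

noncomputable section

open CategoryTheory Function

universe u v

namespace Literature.NumberTheory.GaloisRepresentations

open _root_.TopRep _root_.ContinuousCohomology

variable {R : Type u} [CommRing R] [TopologicalSpace R]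
variable {G : Type v} [Group G] [TopologicalSpace G] [IsTopologicalGroup G]

namespace ContPairing

variable {X₁ Y₁ Z₁ X₂ Y₂ Z₂ : TopRep.{v} R G} (P₁ : ContPairing X₁ Y₁ Z₁) (P₂ : ContPairing X₂ Y₂ Z₂)
  (α : X₂ ⟶ X₁) (β : Y₁ ⟶ Y₂) (γ : Z₁ ⟶ Z₂) (N : Subgroup G) [Fintype (G ⧸ N)]

omit [TopologicalSpace G] [IsTopologicalGroup G] in
/-- The module identity for the summed pairings, mixed variance: if `γ⟨α x, y⟩₁ = ⟨x, β y⟩₂` then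
`γ(Σ_y ⟨α φ y, ψ y⟩₁) = Σ_y ⟨φ y, β ψ y⟩₂`. [cite: NeukirchSchmidtWingberg2008, I §4 (1.4.2)] -/
theorem coindFin_toLin_map_adjoint (hc : ∀ x y, γ.hom (P₁.toLin (α.hom x) y) = P₂.toLin x (β.hom y))
    (φ : _root_.Literature.NumberTheory.GaloisRepresentations.coindFin X₂ N)
    (ψ : _root_.Literature.NumberTheory.GaloisRepresentations.coindFin Y₁ N) :
    γ.hom ((P₁.coindFin N).toLin ((coindFinMap α N).hom φ) ψ) =
      (P₂.coindFin N).toLin φ ((coindFinMap β N).hom ψ) := by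
  rw [coindFin_toLin_apply, coindFin_toLin_apply, map_sum]
  exact Finset.sum_congr rfl fun y _ => by rw [coindFinMap_apply, hc, coindFinMap_apply]

variable [LocallyCompactSpace G]

/-- **Mixed naturality of the cup product of the summed pairings**: if `γ⟨α x, y⟩₁ = ⟨x, β y⟩₂` then
`H²(γ)(H¹(Maps(α)) a ∪_{Σ₁} b) = a ∪_{Σ₂} H¹(Maps(β)) b`. [cite: NeukirchSchmidtWingberg2008, I §4 (1.4.2)] -/
theorem cupProduct_coindFin_map_adjoint (hc : ∀ x y, γ.hom (P₁.toLin (α.hom x) y) = P₂.toLin x (β.hom y))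
    (a : continuousCohomology 1 (_root_.Literature.NumberTheory.GaloisRepresentations.coindFin X₂ N))
    (b : continuousCohomology 1 (_root_.Literature.NumberTheory.GaloisRepresentations.coindFin Y₁ N)) :
    cohomologyMap γ 2 ((P₁.coindFin N).cupProduct (cohomologyMap (coindFinMap α N) 1 a) b) =
      (P₂.coindFin N).cupProduct a (cohomologyMap (coindFinMap β N) 1 b) :=
  cupProduct_map_adjoint (P₁.coindFin N) (P₂.coindFin N) (coindFinMap α N) (coindFinMap β N) γ
    (fun φ ψ => P₁.coindFin_toLin_map_adjoint P₂ α β γ N hc φ ψ) a b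

end ContPairing

section Shapiro

variable {X₁ Y₁ Z₁ X₂ Y₂ Z₂ : TopRep.{v} R G} (P₁ : ContPairing X₁ Y₁ Z₁) (P₂ : ContPairing X₂ Y₂ Z₂)
  (α : X₂ ⟶ X₁) (β : Y₁ ⟶ Y₂) (γ : Z₁ ⟶ Z₂) (N : Subgroup G) [Fintype (G ⧸ N)] [LocallyCompactSpace G]
  (hN : IsOpen (N : Set G)) {s : G ⧸ N → G} (hs : ∀ x : G ⧸ N, (s x : G ⧸ N) = x) (hs1 : s ((1 : G) : G ⧸ N) = 1)

/-- **Level transport of Shapiro cup classes**: for layer classes `a ∈ H¹(N, X₂)`, `b ∈ H¹(N, Y₁)` and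
`γ⟨α x, y⟩₁ = ⟨x, β y⟩₂`,
`H²(γ)( Sh_N(H¹(α|_N) a) ∪_{Σ₁} Sh_N b ) = Sh_N a ∪_{Σ₂} Sh_N(H¹(β|_N) b)` in `H²(G, Z₂)`.
(Shapiro lift natural in the coefficients + mixed naturality of the summed cup product.)
[cite: NeukirchSchmidtWingberg2008, I §6 (1.6.4)] [cite: NeukirchSchmidtWingberg2008, I §4 (1.4.2)] -/
theorem shapiroLift_cupProduct_coindFin_map_adjoint
    (hc : ∀ x y, γ.hom (P₁.toLin (α.hom x) y) = P₂.toLin x (β.hom y))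
    (a : continuousCohomology 1 (subgroupRep X₂ N)) (b : continuousCohomology 1 (subgroupRep Y₁ N)) :
    cohomologyMap γ 2 ((P₁.coindFin N).cupProduct
        (shapiroLift X₁ N hN hs hs1 (cohomologyMap (subgroupRepMap α N) 1 a)) (shapiroLift Y₁ N hN hs hs1 b)) =
      (P₂.coindFin N).cupProduct (shapiroLift X₂ N hN hs hs1 a)
        (shapiroLift Y₂ N hN hs hs1 (cohomologyMap (subgroupRepMap β N) 1 b)) := by
  rw [shapiroLift_cohomologyMap, shapiroLift_cohomologyMap]
  exact ContPairing.cupProduct_coindFin_map_adjoint P₁ P₂ α β γ N hc _ _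

end Shapiro

end Literature.NumberTheory.GaloisRepresentations
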